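import Literature.MathematicalPhysics.QuantumFieldTheory.Balaban1983to89.B9Thm311FlatKernelZdPer
import Literature.MathematicalPhysics.QuantumFieldTheory.Balaban1983to89.B5Eq155FlatAveragingCommute
import Literature.MathematicalPhysics.QuantumFieldTheory.Balaban1983to89.B9Eq34CovCurlVector

/-!
# `Balaban1983to89.B9Eq315PeriodicReadingZdPer` — [Balaban1985Averaging] (1) p. 17 ∕ p. 19 («Ω^{(j)} may be replaced by any other lattice») and
# [Balaban1985BackgroundPropagators] (3.3)–(3.4), (3.8) p. 391–392 AT THE FLAT BACKGROUND: THE (β′) ROAD'S `P`-PERIODIC FIELDS ON `ℤᵈ` ARE THE NE9 CHAIN'S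
# TORUS FIELDS — storey S1 of the dictionary between the pub-balaban NE9 chain's torus carriers (`B4Sect5Torus.TSite`, `B9SectCLatticeCarrier.Bond ∕ Plaq`,
# read on `ℤᵈ` by `B9Eq315QTorus.perCfg`) and the N06 periodic carrier (`T4TermwiseTorus.IsPeriodic`, `box P`, dag-n06-b's `domSubHPer`): the periodic
# reading is a bijection, cell sums are sums over the torus, and the flat derivative ∕ curl ∕ divergence of `B9Eq33CovDerivVector` ∕ `B9Eq34CovCurlVector`
# read on `ℤᵈ` are the stencils `covDerivFwd ∕ plaqCovDeriv ∕ covDivB η 1`; whence the `D*D` square of the energy identity in NE9 currency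

statement-level skeleton of published theorems with citation tags; proofs where landed; nothing here is a claim about the
Yang–Mills mass gap

`[Balaban1985Averaging]` ("B7", CMP **98** (1985) 17–51) (1) p. 17 (the lattice `T_η` and its blocks), p. 19 *«In fact, Ω^{(j)} may be replaced by any
other lattice.»*; `[Balaban1985BackgroundPropagators]` ("B9", CMP **99** (1985) 389–434) (3.3) p. 391 *«(D^η_{U₀}λ)(b) = η⁻¹(R(U₀(b))λ(b₊) − λ(b₋))»*,
(3.4) p. 391 (the plaquette derivative), (3.8) p. 392 (the divergence `D*`), (3.10) p. 392 (`⟨A, Δ(U₀)A⟩ = ‖D^η_{U₀}A‖² + …`); `[Balaban1985RegularSpaces]`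
("B8") p. 77 *«we admit the case when some domains Ω_j are equal to T_η»* (the torus datum), (1.1) p. 76.  PDF held: `paper:balaban1985-cmp99-background-
propagators` pp. 391–392 (via the tree's `B9Eq33CovDerivVector` ∕ `B9Eq34CovCurlVector` docstrings, re-read 2026-08-28).

CITATION HEADER (lean-in-tree rule).  Cell `pub-ymgap` (YM Track A, HUMAN RULINGS D-0062 ∕ D-0149), node N06 = [B9], width seat `pub-ymgap-dag-n06-w3` (g6),
CLAIM-3 ∕ LOCATED-BRIDGE (bus 2026-08-28 14:41Z).  WHY.  dag-n06-j g8 (bus 2026-08-27 08:48Z) located: «the NE9 chain's `B9Thm311SmallFieldCoercivity(Uniform)`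
has the mechanism at other letters, no bridge».  On the (β′-PERIODIC) road of record (director-ym №217) the N06 letters live on `P`-periodic `𝔸`-valued
fields on `ℤᵈ` (`B9Eq327GreenZdHermPer`, `B9Eq326DeltaAPeriodicLettersZd`, `B9Eq321LandauProjectionZdPer`), while the pub-balaban NE9 chain — which holds
the `k`-level flat letters as one-step letters (`B9Eq316TowerFlatIsOneStep`), [B5] (1.90) explicit and volume-free (`B5Eq190FlatCoercivityUniform` ∕
`…SpacingUniform`, from N02's `B5Prop11Lower`) and the curved small-field step (`B9Thm311SmallFieldCoercivity…`) — types the SAME torus as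
`Bond d (fun _ => P) → V` READ ON `ℤᵈ` BY `perCfg` ([B7] p. 19).  THIS FILE is storey S1 of the dictionary: carriers, cell sums, and the three flat
first-order letters; the `R`-, `Q`- and fibre storeys (S2–S4, bus LOCATED-BRIDGE) are separate files.  Inputs BY NAME: `B9Eq315QTorus.perCfg ∕ perSite`,
`B9Eq315QTorusOnto.liftSite ∕ periodVec ∕ perSite_add_periodVec ∕ liftSite_perSite_add ∕ perSite_liftSite`, `B5Eq155FlatAveragingCommute.shift_perSite`,
`B9Eq33CovDerivVector.covDeriv ∕ covDiv`, `B9Eq34CovCurlVector.covCurl`, `B8Eq191FlatStencils.covDerivFwd_flat_apply ∕ covDeriv_flat_apply`, this seat's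
`B9Eq172FlatCurlPoincareZdPer.plaqCovDeriv_one_apply`.

WHAT IS PROVED (kernel, 0 sorry, 0 def; [folklore] bookkeeping between two typings of one printed lattice — the cited sentences are print's use of it).
* §1 ★ `periodVec_const` (`periodVec (fun _ => P) m = (P:ℤ) • m`), ★ `isPeriodic_perCfg` (the periodic reading of a torus bond function IS `P`-periodic),
  `isPeriodic_comp_perSite_const` (site functions), ★ `perCfg_liftSite_restrict` (a `P`-periodic bond field is the reading of its restriction to representatives:
  `perCfg _ (fun b => A (liftSite b.1) b.2) = A`), `comp_perSite_liftSite_restrict` (sites), ★ `isPeriodic_iff_exists_perCfg` (periodic ⟺ a reading).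
* §2 ★ `sum_box_eq_sum_univ_liftSite` (CELL SUMS ARE TORUS SUMS: `Σ_{x∈[0,P)ᵈ} F x = Σ_{y : TSite d (fun _ => P)} F (liftSite y)` — `boxVec = liftSite` by `rfl`),
  `sum_box_perCfg` (`Σ_{x∈box} g (perCfg B x κ) = Σ_y g (B (y, κ))`).
* §3 the flat letters read on `ℤᵈ` ((3.3), (3.4), (3.8) at `U₀ = 1`, scalar `c = η⁻¹`): ★ `perCfg_covDeriv_flat` (`covDeriv ↑η⁻¹ id g` read on `ℤᵈ` = `covDerivFwd η 1`
  of `g ∘ perSite`), `unshift_perSite`, ★ `covCurl_flat_perSite` (`covCurl ↑η⁻¹ id B (perSite x, q) = plaqCovDeriv η 1 (perCfg B) q₁ q₂ x`),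
  ★ `covDiv_flat_perSite` (`covDiv ↑η⁻¹ id B (perSite x) = covDivB η 1 (perCfg B) x`).
* §4 ★ `sum_Iio_eq_sum_dirPair` (`Σ_κ Σ_{ν<κ} F ν κ = Σ_{q : DirPair d} F q₁ q₂`), ★★ `sum_box_plaqCovDeriv_eq_sum_plaq_covCurl` (THE `D*D` SQUARE IN NE9 CURRENCY:
  the right-hand side `Σ_κ Σ_{ν<κ} Σ_{x∈box P} g((D¹A)_{νκ}(x))` of dag-n06-b's energy identity `sum_box_pair_Jcur`, for `A = perCfg B`, is
  `Σ_{p : Plaq d (fun _ => P)} g(covCurl ↑η⁻¹ id B p)` — in particular with `g = a ↦ Re τ(a* a)`).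

HONEST SCOPE.  Count-neutral helper (`--supports` the K1 item of record): index bookkeeping, NO estimate, NO new object (0 `def`); nothing of the NE9 chain's
theorems is transported yet (storeys S2–S4); Thm 3.11 ∕ 3.3 NOT proved; N05 ∕ N06 NOT discharged; K1 NOT closed; one finite `𝕋⁴` programme at fixed `ε`,
Bałaban as printed; R4 closes only the conditional finite-`𝕋⁴` rung `BalabanLadder.UV` — nothing continuum ∕ ℝ⁴ ∕ OS ∕ mass gap ∕ Clay.  Unit
`pub-ymgap-dag-n06-w3` (g6), 2026-08-28; NEW file importing `B9Thm311FlatKernelZdPer`, `B5Eq155FlatAveragingCommute`, `B9Eq34CovCurlVector`; modifies nothing.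
Net new unproved facts: 0.
-/

noncomputable section

open scoped BigOperators

namespace Literature.MathematicalPhysics.QuantumFieldTheory.Balaban1983to89.B9Eq315PeriodicReadingZdPer

open B7Prop1Explicit (e e_apply boxVec)
open B4Sect5Torus (TSite)
open B9SectCLatticeCarrier (Bond DirPair bpos btgt shift unshift unshift_shift)
open B9Eq33CovDerivVector (covDeriv covDeriv_apply covDiv)
open B9Eq34CovCurlVector (covCurl covCurl_apply_coord)
open B9Eq315QTorus (perSite perCfg perCfg_apply)
open B9Eq315QTorusOnto (liftSite periodVec perSite_add_periodVec perSite_liftSite liftSite_perSite_add)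
open B5Eq155FlatAveragingCommute (shift_perSite)
open B8Ineq132 (covDerivFwd)
open B8Eq146AExpansion (plaqCovDeriv)
open B8Eq138LandauZd (covDivB)
open B8Eq191FlatStencils (covDerivFwd_flat_apply covDeriv_flat_apply)
open T4TermwiseTorus (IsPeriodic box mem_box boxVec_injective)
open B9Eq172FlatCurlPoincareZdPer (plaqCovDeriv_one_apply)

variable {d : ℕ}

/-! ## §1  The periodic reading is a bijection: `P`-periodic fields on `ℤᵈ` ⟷ torus fields -/

section Carriers

variable (P : ℕ)

/-- the period vector of the constant period `(P, …, P)` at the multi-index `m` is `P • m`. [cite: Balaban1985Averaging, (1) p.17 (bookkeeping)] -/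
theorem periodVec_const (m : B7Prop1Explicit.Site d) : periodVec (fun _ : Fin d => P) m = (P : ℤ) • m := by
  funext i
  simp [periodVec]

variable [NeZero P]

/-- ★ **THE PERIODIC READING OF A TORUS BOND FUNCTION IS `P`-PERIODIC** ([B7] p. 19 «Ω^{(j)} may be replaced by any other lattice»; the (β′) road's
`T4TermwiseTorus.IsPeriodic`). [cite: Balaban1985Averaging, (1) p.17, p.19; Balaban1985RegularSpaces, p.77 («Ω_j = T_η»)] -/
theorem isPeriodic_perCfg {V : Type*} (B : Bond d (fun _ : Fin d => P) → V) : IsPeriodic P (perCfg (fun _ : Fin d => P) B) := by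
  intro x m
  funext κ
  rw [perCfg_apply, perCfg_apply, ← periodVec_const P m, perSite_add_periodVec]

/-- the periodic reading `g ∘ perSite` of a torus SITE function is `P`-periodic. [cite: Balaban1985Averaging, (1) p.17, p.19] -/
theorem isPeriodic_comp_perSite_const {β : Type*} (g : TSite d (fun _ : Fin d => P) → β) : IsPeriodic P fun x => g (perSite (fun _ : Fin d => P) x) := by
  intro x m
  show g (perSite (fun _ : Fin d => P) (x + (P : ℤ) • m)) = g (perSite (fun _ : Fin d => P) x)
  rw [← periodVec_const P m, perSite_add_periodVec]

/-- ★ **A `P`-PERIODIC BOND FIELD IS THE READING OF ITS RESTRICTION TO THE REPRESENTATIVES**: `perCfg _ (b ↦ A(liftSite b₋, dir b)) = A`.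
[cite: Balaban1985Averaging, (1) p.17, p.19; Balaban1985RegularSpaces, p.77] -/
theorem perCfg_liftSite_restrict {V : Type*} {A : B7Prop1Explicit.Site d → Fin d → V} (hA : IsPeriodic P A) :
    perCfg (fun _ : Fin d => P) (fun b : Bond d (fun _ : Fin d => P) => A (liftSite b.1) b.2) = A := by
  funext x κ
  rw [perCfg_apply]
  have h := congr_fun (hA (liftSite (perSite (fun _ : Fin d => P) x)) (fun i => x i / (P : ℤ))) κ
  rw [← periodVec_const P, liftSite_perSite_add] at h
  exact h.symm

/-- a `P`-periodic SITE function is the reading of its restriction: `f (liftSite (perSite x)) = f x`. [cite: Balaban1985Averaging, (1) p.17, p.19] -/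
theorem comp_perSite_liftSite_restrict {β : Type*} {f : B7Prop1Explicit.Site d → β} (hf : IsPeriodic P f) (x : B7Prop1Explicit.Site d) :
    f (liftSite (perSite (fun _ : Fin d => P) x)) = f x := by
  have h := hf (liftSite (perSite (fun _ : Fin d => P) x)) (fun i => x i / (P : ℤ))
  rw [← periodVec_const P, liftSite_perSite_add] at h
  exact h.symm

/-- ★ **PERIODIC ⟺ A PERIODIC READING** (the two typings of `T_η` agree): `IsPeriodic P A ↔ ∃ B : Bond d (P,…,P) → V, A = perCfg _ B`.
[cite: Balaban1985Averaging, (1) p.17, p.19; Balaban1985RegularSpaces, p.77] -/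
theorem isPeriodic_iff_exists_perCfg {V : Type*} (A : B7Prop1Explicit.Site d → Fin d → V) :
    IsPeriodic P A ↔ ∃ B : Bond d (fun _ : Fin d => P) → V, A = perCfg (fun _ : Fin d => P) B :=
  ⟨fun hA => ⟨fun b => A (liftSite b.1) b.2, (perCfg_liftSite_restrict P hA).symm⟩, fun ⟨B, hB⟩ => hB ▸ isPeriodic_perCfg P B⟩

end Carriers

/-! ## §2  Cell sums are torus sums -/

section Sums

variable (P : ℕ)

/-- the box vector of `r : Fin d → Fin P` IS the representative `liftSite r` of the torus site `r`. [cite: Balaban1985Averaging, (1)–(2) p.17 (bookkeeping)] -/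
theorem boxVec_eq_liftSite (r : TSite d (fun _ : Fin d => P)) : boxVec P r = liftSite r := rfl

/-- ★ **CELL SUMS ARE TORUS SUMS**: `Σ_{x ∈ [0,P)ᵈ} F x = Σ_{y : TSite d (P,…,P)} F (liftSite y)` (the cell `box P` is the injective image of the
representatives). [cite: Balaban1985Averaging, (1)–(2) p.17, (4) p.18; Balaban1985RegularSpaces, p.77] -/
theorem sum_box_eq_sum_univ_liftSite {M : Type*} [AddCommMonoid M] (F : B7Prop1Explicit.Site d → M) :
    ∑ x ∈ box (d := d) P, F x = ∑ y : TSite d (fun _ : Fin d => P), F (liftSite y) := by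
  rw [box, Finset.sum_image fun r _ r' _ h => boxVec_injective P h]
  rfl

variable [NeZero P]

/-- **cell sums of a reading**: `Σ_{x ∈ [0,P)ᵈ} g(perCfg B x κ) = Σ_{y} g(B (y, κ))`. [cite: Balaban1985Averaging, (1) p.17, (4) p.18] -/
theorem sum_box_perCfg {V M : Type*} [AddCommMonoid M] (B : Bond d (fun _ : Fin d => P) → V) (g : V → M) (κ : Fin d) :
    ∑ x ∈ box (d := d) P, g (perCfg (fun _ : Fin d => P) B x κ) = ∑ y : TSite d (fun _ : Fin d => P), g (B (y, κ)) := by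
  rw [sum_box_eq_sum_univ_liftSite]
  exact Finset.sum_congr rfl fun y _ => by rw [perCfg_apply, perSite_liftSite]

end Sums

/-! ## §3  The flat first-order letters of `B9Eq33CovDerivVector` ∕ `B9Eq34CovCurlVector` read on `ℤᵈ` -/

section Letters

variable (P : ℕ) [NeZero P] {𝔸 : Type*} [CStarAlgebra 𝔸] (η : ℝ)

/-- **THE TORUS BACKWARD STEP IS THE `ℤᵈ` STEP `− e_μ`** under the periodic reading (companion of `B5Eq155FlatAveragingCommute.shift_perSite`).
[cite: Balaban1985Averaging, (1) p.17] -/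
theorem unshift_perSite (x : B7Prop1Explicit.Site d) (μ : Fin d) :
    unshift μ (perSite (fun _ : Fin d => P) x) = perSite (fun _ : Fin d => P) (x - e μ) := by
  have h : shift μ (perSite (fun _ : Fin d => P) (x - e μ)) = perSite (fun _ : Fin d => P) x := by
    rw [shift_perSite, sub_add_cancel]
  rw [← h, unshift_shift]

omit [NeZero P] in
/-- the real scalar `η⁻¹` read in `ℂ` acts as `η⁻¹`. [folklore] -/
private theorem coe_inv_smul (a : 𝔸) : ((η⁻¹ : ℝ) : ℂ) • a = η⁻¹ • a := Complex.coe_smul _ _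

/-- ★ **(3.3) AT `U₀ = 1`, READ ON `ℤᵈ`**: the NE9 chain's flat derivative `covDeriv ↑η⁻¹ id g` of a torus site function, read on `ℤᵈ` through `perCfg`, is
the stencil `covDerivFwd η 1` of the reading `g ∘ perSite`. [cite: Balaban1985BackgroundPropagators, (3.3) p.391; Balaban1985Averaging, p.19] -/
theorem perCfg_covDeriv_flat (g : TSite d (fun _ : Fin d => P) → 𝔸) :
    perCfg (fun _ : Fin d => P) (covDeriv (((η⁻¹ : ℝ) : ℂ)) (fun _ => LinearMap.id) g) =
      fun x μ => covDerivFwd η (1 : B7Prop1Explicit.Site d → Fin d → 𝔸ˣ) μ (fun z => g (perSite (fun _ : Fin d => P) z)) x := by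
  funext x μ
  rw [perCfg_apply, B9Eq33CovDerivVector.covDeriv_apply_flat, covDerivFwd_flat_apply, coe_inv_smul]
  change η⁻¹ • (g (shift μ (perSite (fun _ : Fin d => P) x)) - g (perSite (fun _ : Fin d => P) x)) = _
  rw [shift_perSite]

/-- ★ **(3.4) AT `U₀ = 1`, READ ON `ℤᵈ`**: the NE9 chain's flat curl at the plaquette `(perSite x; μ < ν)` is the stencil `plaqCovDeriv η 1` of the reading at
`p_{μν}(x)`. [cite: Balaban1985BackgroundPropagators, (3.4) p.391; Balaban1985Averaging, p.19] -/
theorem covCurl_flat_perSite (B : Bond d (fun _ : Fin d => P) → 𝔸) (x : B7Prop1Explicit.Site d) (q : DirPair d) :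
    covCurl (((η⁻¹ : ℝ) : ℂ)) (fun _ => LinearMap.id) B (perSite (fun _ : Fin d => P) x, q) =
      plaqCovDeriv η (1 : B7Prop1Explicit.Site d → Fin d → 𝔸ˣ) (perCfg (fun _ : Fin d => P) B) q.1.1 q.1.2 x := by
  rw [covCurl_apply_coord, plaqCovDeriv_one_apply, coe_inv_smul, coe_inv_smul, ← smul_sub]
  simp only [LinearMap.id_apply, perCfg_apply, shift_perSite]
  congr 1
  abel

/-- ★ **(3.8) AT `U₀ = 1`, READ ON `ℤᵈ`**: the NE9 chain's flat divergence at `perSite x` is the stencil `covDivB η 1` of the reading at `x`.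
[cite: Balaban1985BackgroundPropagators, (3.8) p.392; Balaban1985RegularSpaces, (1.1) p.76, (1.38) p.82] -/
theorem covDiv_flat_perSite (B : Bond d (fun _ : Fin d => P) → 𝔸) (x : B7Prop1Explicit.Site d) :
    covDiv (((η⁻¹ : ℝ) : ℂ)) (fun _ => LinearMap.id) B (perSite (fun _ : Fin d => P) x) =
      covDivB η (1 : B7Prop1Explicit.Site d → Fin d → 𝔸ˣ) (perCfg (fun _ : Fin d => P) B) x := by
  rw [B9Eq33CovDerivVector.covDiv_apply, covDivB, coe_inv_smul, Finset.smul_sum]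
  refine Finset.sum_congr rfl fun μ _ => ?_
  rw [covDeriv_flat_apply, perCfg_apply, perCfg_apply, LinearMap.id_apply, unshift_perSite]

end Letters

/-! ## §4  The `D*D` square of the energy identity in NE9 currency -/

section Energy

variable (P : ℕ) [NeZero P] {𝔸 : Type*} [CStarAlgebra 𝔸] (η : ℝ)

omit [NeZero P] in
/-- ★ **ORDERED DIRECTION PAIRS**: `Σ_κ Σ_{ν<κ} F ν κ = Σ_{q : DirPair d} F q₁ q₂` (the tree's `DirPair d = {q // q.1 < q.2}`).
[cite: Balaban1985BackgroundPropagators, (3.4) p.391 («μ < ν»; bookkeeping)] -/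
theorem sum_Iio_eq_sum_dirPair {M : Type*} [AddCommMonoid M] (F : Fin d → Fin d → M) :
    ∑ κ : Fin d, ∑ ν ∈ Finset.Iio κ, F ν κ = ∑ q : DirPair d, F q.1.1 q.1.2 := by
  classical
  -- both sides are the sum over the filtered square `{(ν, κ) | ν < κ}`
  have hR : ∑ q : DirPair d, F q.1.1 q.1.2 = ∑ q ∈ (Finset.univ : Finset (Fin d × Fin d)).filter (fun q => q.1 < q.2), F q.1 q.2 :=
    (Finset.sum_subtype ((Finset.univ : Finset (Fin d × Fin d)).filter (fun q => q.1 < q.2)) (fun q => by simp) (fun q => F q.1 q.2)).symm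
  have hL : ∑ κ : Fin d, ∑ ν ∈ Finset.Iio κ, F ν κ = ∑ q ∈ (Finset.univ : Finset (Fin d × Fin d)).filter (fun q => q.1 < q.2), F q.1 q.2 := by
    rw [Finset.sum_filter, ← Finset.univ_product_univ, Finset.sum_product, Finset.sum_comm]
    refine Finset.sum_congr rfl fun κ _ => ?_
    rw [← Finset.sum_filter]
    congr 1
    ext ν
    simp [Finset.mem_Iio]
  rw [hL, hR]

/-- ★★ **THE `D*D` SQUARE IN NE9 CURRENCY**: for a torus bond function `B` read on `ℤᵈ` as `A = perCfg _ B`, the right-hand side of dag-n06-b's energy identity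
`sum_box_pair_Jcur` — `Σ_κ Σ_{ν<κ} Σ_{x∈[0,P)ᵈ} g((D^η_1A)_{νκ}(x))` — is the sum over the NE9 chain's plaquettes `Σ_{p : Plaq d (P,…,P)} g((covCurl ↑η⁻¹ id B)(p))`
(any `g`, e.g. `a ↦ Re τ(a* a)`): the flat `‖D¹A‖²` of [B9] (3.10) agrees across the two typings. [cite: Balaban1985BackgroundPropagators, (3.4) p.391, (3.10) p.392; Balaban1985Averaging, p.19] -/
theorem sum_box_plaqCovDeriv_eq_sum_plaq_covCurl {M : Type*} [AddCommMonoid M] (B : Bond d (fun _ : Fin d => P) → 𝔸) (g : 𝔸 → M) :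
    ∑ κ : Fin d, ∑ ν ∈ Finset.Iio κ, ∑ x ∈ box (d := d) P,
        g (plaqCovDeriv η (1 : B7Prop1Explicit.Site d → Fin d → 𝔸ˣ) (perCfg (fun _ : Fin d => P) B) ν κ x) =
      ∑ p : B9SectCLatticeCarrier.Plaq d (fun _ : Fin d => P), g (covCurl (((η⁻¹ : ℝ) : ℂ)) (fun _ => LinearMap.id) B p) := by
  rw [sum_Iio_eq_sum_dirPair (fun ν κ => ∑ x ∈ box (d := d) P,
    g (plaqCovDeriv η (1 : B7Prop1Explicit.Site d → Fin d → 𝔸ˣ) (perCfg (fun _ : Fin d => P) B) ν κ x))]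
  have hR : ∑ p : B9SectCLatticeCarrier.Plaq d (fun _ : Fin d => P), g (covCurl (((η⁻¹ : ℝ) : ℂ)) (fun _ => LinearMap.id) B p) =
      ∑ y : TSite d (fun _ : Fin d => P), ∑ q : DirPair d, g (covCurl (((η⁻¹ : ℝ) : ℂ)) (fun _ => LinearMap.id) B (y, q)) :=
    Fintype.sum_prod_type fun p : B9SectCLatticeCarrier.Plaq d (fun _ : Fin d => P) => g (covCurl (((η⁻¹ : ℝ) : ℂ)) (fun _ => LinearMap.id) B p)
  rw [hR]
  simp_rw [sum_box_eq_sum_univ_liftSite P]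
  rw [Finset.sum_comm]
  refine Finset.sum_congr rfl fun y _ => ?_
  refine Finset.sum_congr rfl fun q _ => ?_
  rw [← covCurl_flat_perSite P η B (liftSite y) q, perSite_liftSite]

end Energy

end Literature.MathematicalPhysics.QuantumFieldTheory.Balaban1983to89.B9Eq315PeriodicReadingZdPer

end
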